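import Literature.Probability.Percolation.TileDataOfZones
import Literature.Probability.LatticeModels.DomainDiscretisation
import Mathlib.Topology.MetricSpace.Thickening
import HarnessLib

/-!
# The blocks of a cut: digitising the tube and the collar at scale `s`

Topic `Probability/Percolation`.  Support file (definitions and proofs, no named fact) for the
named fact `SchrammSmirnov2011_thm_1_7`: the first piece of the zone geometry behind the
bays-and-beaches construction of the proof of Prop. 4.1 (Ann. Probab. 39 (2011), §4, "let
`K ⊆ [Q₀]` be the closure of the `s`-neighbourhood of `α` minus …"), in the RECTILINEAR form
required by the straight windows of `CollarWindowArms.lean`.  The plane is tiled by the closed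
`s`-blocks `s(z + [0,1]²)`, `z ∈ ℤ²`; the TUBE blocks are those meeting the open
`s/2`-neighbourhood of the cut `α`, the RING blocks the other blocks at sup-distance `1` from a
tube block.  At mesh `δ < s` the tube sites `N` (mesh points in a tube block) and collar sites `K`
(mesh points in a ring block, not in `N`) are finite (`Nset_finite`, `Kset_finite`), every lattice
neighbour of a tube site is a tube or collar site (`nbr_mem_of_mem_Nset`, the hypothesis
`Zones.Nice.N_nbr` with no squares), every site within distance `< s` of a tube site is a tube or
collar site (`mem_of_dist_lt`: the collar has width `s`, so far sites are at distance `≥ s` from the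
tube), and collar sites are at distance `≥ s/2` from the cut (`infDist_le_of_mem_Kset`: the quads
drawn in the collar avoid `α`).

## References

* O. Schramm, S. Smirnov, *On the scaling limits of planar percolation*, Ann. Probab. 39 (2011)
  1768–1814, arXiv:1101.5820, §4, proof of Prop. 4.1 (the sets `K`, `β`, `β'`). [SchrammSmirnov2011]
-/

noncomputable section

open Set Metric
open Literature.Probability.LatticeModels

namespace Literature.Probability.Percolation

namespace CutBlocks

variable (s : ℝ)

/-- The closed `s`-block with lower-left corner `s z`. [folklore] -/
def block (z : ℤ × ℤ) : Set ℂ :=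
  {w | s * z.1 ≤ w.re ∧ w.re ≤ s * (z.1 + 1) ∧ s * z.2 ≤ w.im ∧ w.im ≤ s * (z.2 + 1)}

/-- The block of a point (lower-left convention). [folklore] -/
def blockOf (w : ℂ) : ℤ × ℤ := (⌊w.re / s⌋, ⌊w.im / s⌋)

variable {s}

/-- Every point lies in its block. [folklore] -/
theorem mem_block_blockOf (hs : 0 < s) (w : ℂ) : w ∈ block s (blockOf s w) := by
  simp only [block, blockOf, mem_setOf_eq]
  have h1 : (⌊w.re / s⌋ : ℝ) * s ≤ w.re := (le_div_iff₀ hs).1 (Int.floor_le _)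
  have h2 : w.re < ((⌊w.re / s⌋ : ℝ) + 1) * s := (div_lt_iff₀ hs).1 (Int.lt_floor_add_one _)
  have h3 : (⌊w.im / s⌋ : ℝ) * s ≤ w.im := (le_div_iff₀ hs).1 (Int.floor_le _)
  have h4 : w.im < ((⌊w.im / s⌋ : ℝ) + 1) * s := (div_lt_iff₀ hs).1 (Int.lt_floor_add_one _)
  refine ⟨?_, ?_, ?_, ?_⟩ <;> linarith

/-- **Nearby points lie in sup-adjacent blocks**: if `w ∈ block s z` and `w'` is within `< s` of
`w` in both coordinates, the block of `w'` is at sup-distance `≤ 1` from `z`. [folklore] -/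
theorem blockOf_near (hs : 0 < s) {w w' : ℂ} {z : ℤ × ℤ} (hw : w ∈ block s z)
    (hre : |w'.re - w.re| < s) (him : |w'.im - w.im| < s) :
    |(blockOf s w').1 - z.1| ≤ 1 ∧ |(blockOf s w').2 - z.2| ≤ 1 := by
  obtain ⟨h1, h2, h3, h4⟩ := hw
  rw [abs_lt] at hre him
  simp only [blockOf]
  constructor
  · rw [abs_le]
    constructor
    · have : (z.1 : ℝ) - 1 < w'.re / s := by rw [lt_div_iff₀ hs]; nlinarith
      have := Int.floor_le_floor this.le
      have e : ⌊(z.1 : ℝ) - 1⌋ = z.1 - 1 := by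
        rw [show (z.1 : ℝ) - 1 = ((z.1 - 1 : ℤ) : ℝ) by push_cast; ring, Int.floor_intCast]
      omega
    · have : w'.re / s < z.1 + 2 := by rw [div_lt_iff₀ hs]; nlinarith
      have := Int.floor_lt.2 (this.trans_le (by push_cast; linarith : (z.1 : ℝ) + 2 ≤ ((z.1 + 2 : ℤ) : ℝ)))
      omega
  · rw [abs_le]
    constructor
    · have : (z.2 : ℝ) - 1 < w'.im / s := by rw [lt_div_iff₀ hs]; nlinarith
      have := Int.floor_le_floor this.le
      have e : ⌊(z.2 : ℝ) - 1⌋ = z.2 - 1 := by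
        rw [show (z.2 : ℝ) - 1 = ((z.2 - 1 : ℤ) : ℝ) by push_cast; ring, Int.floor_intCast]
      omega
    · have : w'.im / s < z.2 + 2 := by rw [div_lt_iff₀ hs]; nlinarith
      have := Int.floor_lt.2 (this.trans_le (by push_cast; linarith : (z.2 : ℝ) + 2 ≤ ((z.2 + 2 : ℤ) : ℝ)))
      omega

/-- Points of a block are within `s √2 ≤ 2 s`… more simply: the coordinates of two points of one
block differ by at most `s`. [folklore] -/
theorem abs_sub_le_of_mem_block {w w' : ℂ} {z : ℤ × ℤ} (hw : w ∈ block s z) (hw' : w' ∈ block s z) :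
    |w'.re - w.re| ≤ s ∧ |w'.im - w.im| ≤ s := by
  obtain ⟨h1, h2, h3, h4⟩ := hw
  obtain ⟨h1', h2', h3', h4'⟩ := hw'
  constructor <;> rw [abs_le] <;> constructor <;> linarith

/-! ### Tube blocks and ring blocks of a cut -/

variable (s) (α : Set ℂ)

/-- **Tube blocks**: the blocks meeting the open `s/2`-neighbourhood of the cut. [cite: SchrammSmirnov2011, §4, proof of Prop. 4.1 (the neighbourhood of α)] -/
def tubeBlocks : Set (ℤ × ℤ) := {z | (block s z ∩ thickening (s / 2) α).Nonempty}

/-- **Ring blocks**: the other blocks at sup-distance `1` from a tube block (the collar `K`, one block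
wide). [cite: SchrammSmirnov2011, §4, proof of Prop. 4.1 (the strip K)] -/
def ringBlocks : Set (ℤ × ℤ) :=
  {z | z ∉ tubeBlocks s α ∧ ∃ z' ∈ tubeBlocks s α, |z.1 - z'.1| ≤ 1 ∧ |z.2 - z'.2| ≤ 1}

variable {s α}

/-- Blocks meeting a bounded set form a finite set. [folklore] -/
theorem finite_blocks_meeting (hs : 0 < s) {T : Set ℂ} (hT : Bornology.IsBounded T) :
    {z : ℤ × ℤ | (block s z ∩ T).Nonempty}.Finite := by
  obtain ⟨r, hr⟩ := (Metric.isBounded_iff_subset_closedBall (0 : ℂ)).1 hT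
  have key : ∀ z : ℤ × ℤ, (block s z ∩ T).Nonempty → |(z.1 : ℝ)| ≤ r / s + 1 ∧ |(z.2 : ℝ)| ≤ r / s + 1 := by
    rintro z ⟨w, ⟨h1, h2, h3, h4⟩, hwT⟩
    have hw : ‖w‖ ≤ r := by simpa using hr hwT
    have hre : |w.re| ≤ r := (Complex.abs_re_le_norm w).trans hw
    have him : |w.im| ≤ r := (Complex.abs_im_le_norm w).trans hw
    rw [abs_le] at hre him
    have hz1 : (z.1 : ℝ) ≤ r / s := by rw [le_div_iff₀ hs]; nlinarith
    have hz1' : -r / s ≤ (z.1 : ℝ) + 1 := by rw [div_le_iff₀ hs]; nlinarith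
    have hz2 : (z.2 : ℝ) ≤ r / s := by rw [le_div_iff₀ hs]; nlinarith
    have hz2' : -r / s ≤ (z.2 : ℝ) + 1 := by rw [div_le_iff₀ hs]; nlinarith
    rw [neg_div] at hz1' hz2'
    constructor <;> rw [abs_le] <;> constructor <;> linarith
  set R : ℤ := ⌈r / s + 1⌉ with hR
  refine ((Set.finite_Icc (-R) R).prod (Set.finite_Icc (-R) R)).subset fun z hz => ?_
  obtain ⟨h1, h2⟩ := key z hz
  rw [abs_le] at h1 h2
  have hR' : r / s + 1 ≤ R := Int.le_ceil _
  simp only [mem_prod, mem_Icc]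
  refine ⟨⟨?_, ?_⟩, ?_, ?_⟩
  · have : (-(R : ℝ)) ≤ z.1 := by linarith
    exact_mod_cast this
  · have : (z.1 : ℝ) ≤ R := by linarith
    exact_mod_cast this
  · have : (-(R : ℝ)) ≤ z.2 := by linarith
    exact_mod_cast this
  · have : (z.2 : ℝ) ≤ R := by linarith
    exact_mod_cast this

/-- The tube blocks of a bounded cut form a finite set. [folklore] -/
theorem tubeBlocks_finite (hs : 0 < s) (hα : Bornology.IsBounded α) : (tubeBlocks s α).Finite :=
  finite_blocks_meeting hs hα.thickening

/-- The ring blocks of a bounded cut form a finite set. [folklore] -/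
theorem ringBlocks_finite (hs : 0 < s) (hα : Bornology.IsBounded α) : (ringBlocks s α).Finite := by
  have hfin := tubeBlocks_finite hs hα
  -- the ring is contained in the image of `tube × {-1,0,1}²`
  have : ringBlocks s α ⊆ ⋃ z' ∈ tubeBlocks s α, (fun d : ℤ × ℤ => (z'.1 + d.1, z'.2 + d.2)) '' (Icc (-1 : ℤ) 1 ×ˢ Icc (-1 : ℤ) 1) := by
    rintro z ⟨-, z', hz', h1, h2⟩
    simp only [mem_iUnion, mem_image, mem_prod, mem_Icc, exists_prop]
    rw [abs_le] at h1 h2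
    exact ⟨z', hz', (z.1 - z'.1, z.2 - z'.2), ⟨⟨by omega, by omega⟩, by omega, by omega⟩, by ext <;> simp⟩
  exact (hfin.biUnion fun z' _ => ((Set.finite_Icc _ _).prod (Set.finite_Icc _ _)).image _).subset this

/-! ### Tube sites and collar sites at mesh `δ` -/

variable (s α) (δ : ℝ)

/-- **Tube sites**: mesh points lying in a tube block. [cite: SchrammSmirnov2011, §4, proof of Prop. 4.1] -/
def Nset : Set (Site 2) := {v | ∃ z ∈ tubeBlocks s α, meshPoint δ v ∈ block s z}

/-- **Collar sites**: mesh points lying in a ring block and in no tube block. [cite: SchrammSmirnov2011, §4, proof of Prop. 4.1] -/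
def Kset : Set (Site 2) := {v | ∃ z ∈ ringBlocks s α, meshPoint δ v ∈ block s z} \ Nset s α δ

variable {s α δ}

/-- Sites whose mesh points lie in finitely many blocks form a finite set. [folklore] -/
theorem finite_sites_of_blocks (hδ : 0 < δ) {B : Set (ℤ × ℤ)} (hB : B.Finite) :
    {v : Site 2 | ∃ z ∈ B, meshPoint δ v ∈ block s z}.Finite := by
  have : {v : Site 2 | ∃ z ∈ B, meshPoint δ v ∈ block s z} = ⋃ z ∈ B, meshVertices (block s z) δ := by
    ext v; simp [meshVertices]
  rw [this]
  refine hB.biUnion fun z _ => meshVertices_finite ?_ hδ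
  -- a block is bounded
  rw [Metric.isBounded_iff_subset_closedBall (⟨s * z.1, s * z.2⟩ : ℂ)]
  refine ⟨2 * s, fun w hw => ?_⟩
  obtain ⟨h1, h2, h3, h4⟩ := hw
  rw [mem_closedBall, Complex.dist_eq]
  refine (Complex.norm_le_abs_re_add_abs_im _).trans ?_
  simp only [Complex.sub_re, Complex.sub_im]
  rw [abs_of_nonneg (by linarith), abs_of_nonneg (by linarith)]
  nlinarith

/-- The tube sites of a bounded cut form a finite set. [folklore] -/
theorem Nset_finite (hs : 0 < s) (hδ : 0 < δ) (hα : Bornology.IsBounded α) : (Nset s α δ).Finite :=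
  finite_sites_of_blocks hδ (tubeBlocks_finite hs hα)

/-- The collar sites of a bounded cut form a finite set. [folklore] -/
theorem Kset_finite (hs : 0 < s) (hδ : 0 < δ) (hα : Bornology.IsBounded α) : (Kset s α δ).Finite :=
  (finite_sites_of_blocks hδ (ringBlocks_finite hs hα)).subset fun _ hv => hv.1

/-- Tube and collar sites are disjoint. [folklore] -/
theorem disjoint_Kset_Nset : Disjoint (Kset s α δ) (Nset s α δ) :=
  disjoint_sdiff_left

/-- **The collar surrounds the tube**: a site whose mesh point is within `< s` (in both
coordinates) of the mesh point of a tube site is a tube site or a collar site. [folklore] -/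
theorem mem_of_near_Nset (hs : 0 < s) {v u : Site 2} (hv : v ∈ Nset s α δ)
    (hre : |(meshPoint δ u).re - (meshPoint δ v).re| < s) (him : |(meshPoint δ u).im - (meshPoint δ v).im| < s) :
    u ∈ Nset s α δ ∨ u ∈ Kset s α δ := by
  by_cases huN : u ∈ Nset s α δ
  · exact Or.inl huN
  · right
    obtain ⟨z, hz, hvz⟩ := hv
    refine ⟨⟨blockOf s (meshPoint δ u), ⟨?_, z, hz, blockOf_near hs hvz hre him⟩, mem_block_blockOf hs _⟩, huN⟩
    -- the block of `u` is not a tube block (else `u ∈ N`)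
    exact fun h => huN ⟨_, h, mem_block_blockOf hs _⟩

/-- **Lattice neighbours of tube sites are tube or collar sites** (the hypothesis `Zones.Nice.N_nbr`
without squares), for meshes `δ < s`. [folklore] -/
theorem nbr_mem_of_mem_Nset (hs : 0 < s) (hδ : 0 < δ) (hδs : δ < s) {v : Site 2} (hv : v ∈ Nset s α δ) (k : Fin 4) :
    v + cornerUnit k ∈ Nset s α δ ∨ v + cornerUnit k ∈ Kset s α δ := by
  refine mem_of_near_Nset hs hv ?_ ?_
  · rw [meshPoint_re, meshPoint_re]
    have : |δ * ((v + cornerUnit k) 0 : ℝ) - δ * (v 0 : ℝ)| ≤ δ := by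
      rw [← mul_sub, abs_mul, abs_of_pos hδ]
      refine mul_le_of_le_one_right hδ.le ?_
      fin_cases k <;> simp [cornerUnit]
    linarith
  · rw [meshPoint_im, meshPoint_im]
    have : |δ * ((v + cornerUnit k) 1 : ℝ) - δ * (v 1 : ℝ)| ≤ δ := by
      rw [← mul_sub, abs_mul, abs_of_pos hδ]
      refine mul_le_of_le_one_right hδ.le ?_
      fin_cases k <;> simp [cornerUnit]
    linarith

/-- **Far sites are at distance `≥ s` from the tube**: a site at Euclidean distance `< s` from a
tube site is a tube or collar site. [folklore] -/
theorem mem_of_dist_lt (hs : 0 < s) {v u : Site 2} (hv : v ∈ Nset s α δ)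
    (hd : dist (meshPoint δ u) (meshPoint δ v) < s) : u ∈ Nset s α δ ∨ u ∈ Kset s α δ := by
  refine mem_of_near_Nset hs hv ?_ ?_
  · exact lt_of_le_of_lt (by simpa using Complex.abs_re_le_norm (meshPoint δ u - meshPoint δ v)) (by rwa [← Complex.dist_eq])
  · exact lt_of_le_of_lt (by simpa using Complex.abs_im_le_norm (meshPoint δ u - meshPoint δ v)) (by rwa [← Complex.dist_eq])

/-- **Collar sites are away from the cut**: the mesh point of a collar site is not in the open
`s/2`-neighbourhood of `α`. [cite: SchrammSmirnov2011, §4, proof of Prop. 4.1 (quads in D ∖ α)] -/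
theorem not_mem_thickening_of_mem_Kset {v : Site 2} (hv : v ∈ Kset s α δ) :
    meshPoint δ v ∉ thickening (s / 2) α := by
  obtain ⟨⟨z, ⟨hz, -⟩, hvz⟩, -⟩ := hv
  exact fun h => hz ⟨_, hvz, h⟩

/-- The same as a distance bound: `s/2 ≤ infDist (meshPoint δ v) α` for a collar site `v` (when
`α` is nonempty). [folklore] -/
theorem le_infDist_of_mem_Kset (hα : α.Nonempty) {v : Site 2} (hv : v ∈ Kset s α δ) :
    s / 2 ≤ infDist (meshPoint δ v) α := by
  have h := not_mem_thickening_of_mem_Kset hv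
  rw [mem_thickening_iff_infDist_lt hα, not_lt] at h
  exact h

/-- **The tube contains the cut's neighbourhood**: a mesh point in the open `s/2`-neighbourhood of
`α` is a tube site. [folklore] -/
theorem mem_Nset_of_mem_thickening (hs : 0 < s) {v : Site 2} (hv : meshPoint δ v ∈ thickening (s / 2) α) :
    v ∈ Nset s α δ :=
  ⟨blockOf s (meshPoint δ v), ⟨_, mem_block_blockOf hs _, hv⟩, mem_block_blockOf hs _⟩

/-! ### The zones of the cut -/

/-- **The zones of the cut at scale `s` and mesh `δ`**: collar `K`, tube `N`, no squares.
[cite: SchrammSmirnov2011, §4, proof of Prop. 4.1] -/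
def zones (hs : 0 < s) (hδ : 0 < δ) (hα : Bornology.IsBounded α) : Seeded.Zones where
  K := (Kset_finite (α := α) hs hδ hα).toFinset
  N := (Nset_finite (α := α) hs hδ hα).toFinset
  SQ := ∅
  disjoint_K_N := by
    rw [Finset.disjoint_left]
    intro v hv hv'
    rw [Set.Finite.mem_toFinset] at hv hv'
    exact Set.disjoint_left.1 disjoint_Kset_Nset hv hv'
  disjoint_K_SQ := Finset.disjoint_empty_right _
  disjoint_N_SQ := Finset.disjoint_empty_right _

/-- Membership in the collar of the zones. [folklore] -/
@[simp] theorem mem_zones_K (hs : 0 < s) (hδ : 0 < δ) (hα : Bornology.IsBounded α) {v : Site 2} :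
    v ∈ (zones hs hδ hα).K ↔ v ∈ Kset s α δ := Set.Finite.mem_toFinset _

/-- Membership in the tube of the zones. [folklore] -/
@[simp] theorem mem_zones_N (hs : 0 < s) (hδ : 0 < δ) (hα : Bornology.IsBounded α) {v : Site 2} :
    v ∈ (zones hs hδ hα).N ↔ v ∈ Nset s α δ := Set.Finite.mem_toFinset _

/-- The zones have no squares. [folklore] -/
@[simp] theorem zones_SQ (hs : 0 < s) (hδ : 0 < δ) (hα : Bornology.IsBounded α) : (zones hs hδ hα).SQ = ∅ := rfl

/-- **The `N_nbr` property of the zones of a cut** (for meshes `δ < s`). [folklore] -/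
theorem zones_N_nbr (hs : 0 < s) (hδ : 0 < δ) (hδs : δ < s) (hα : Bornology.IsBounded α) :
    ∀ v ∈ (zones hs hδ hα).N, ∀ k : Fin 4, v + cornerUnit k ∈ (zones hs hδ hα).K ∨
      v + cornerUnit k ∈ (zones hs hδ hα).N ∨ v + cornerUnit k ∈ (zones hs hδ hα).SQ := by
  intro v hv k
  rw [mem_zones_N] at hv
  rcases nbr_mem_of_mem_Nset hs hδ hδs hv k with h | h
  · exact Or.inr (Or.inl ((mem_zones_N hs hδ hα).2 h))
  · exact Or.inl ((mem_zones_K hs hδ hα).2 h)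

/-- **Far sites of the zones are at distance `≥ s` from every tube site.** [folklore] -/
theorem le_dist_of_mem_Far (hs : 0 < s) (hδ : 0 < δ) (hα : Bornology.IsBounded α) {u v : Site 2}
    (hu : u ∈ (zones hs hδ hα).Far) (hv : v ∈ (zones hs hδ hα).N) : s ≤ dist (meshPoint δ u) (meshPoint δ v) := by
  by_contra h
  push Not at h
  rw [mem_zones_N] at hv
  rcases mem_of_dist_lt hs hv h with h' | h'
  · exact hu.2.1 ((mem_zones_N hs hδ hα).2 h')
  · exact hu.1 ((mem_zones_K hs hδ hα).2 h')

end CutBlocks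

end Literature.Probability.Percolation

end
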